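import Literature.MathematicalPhysics.QuantumFieldTheory.Balaban1983to89.Node00.Record13SepCoPR
import Literature.MathematicalPhysics.QuantumFieldTheory.Balaban1983to89.Node00.Record13CarriersCoPR

/-!
# NODE 00 (YM-PLAN Track A) — THE STAGE-13 CARRIER PINS AT THE v1.6 PROVISOS `Provisos₁₃SepCoPR` (row P11 on print's separated sequences, partition-compatible runs and print's
# (7)-regular data, background row AT PRINT'S BACKGROUND `UbgOfRecord₁₃CoP`, the residual 𝐓-weight rows RUN-INDEXED `zrLaws ∕ zrLocal`) TRANSPORT ALONG EVERY R-LEVEL `X`-RE-BINDING AND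
# EVERY R-LEVEL PIN, the datum `datumOfRecord₁₃SepCoPR` IS UP-SIDE (`rfl`), and the v1.6 record `IsRecordOfRecord₁₃CSepCoPR` is presented at any re-bound ∕ [B10]- ∕ [B13]- ∕ X-pinned
# Stage-13 `CoPR` view — the rev-22 twin leaf of `Record13CarriersSepCoP` (p523276) under node00-def-T's v1.6 token map T₆ (`CoP ↦ CoPR`, `θ : Stage13Params ↦ θ : Stage13RParams`,
# `ztLaws ∕ ztLocal ↦ zrLaws ∕ zrLocal`) (seat `pub-ymgap-dag-n10-d` g9, the ₁₃ carriers' declarer of record — dag-lead WORDS-130; director-ym №169 H1 ∕ №174 PRESS WORD; count-neutral)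

NODE 00 RECORD MODULE at Stage 13, v1.6 vocabulary (node00-def-T g19's `Node00/Record13SepCoPR.lean` p529780 ✓ — FILE 26T = RECORD 13 §11 over the v1.6 edition `Node00/Record13CoPR`
p529474 ✓ (the params layer `Stage13RParams` = `Stage13Params` + the run-indexed residual 𝐓-weight slot `Zr`, def-T LOCATED-8 ∕ director-ym №169 H1): FLAT
`structure Stage13RParams.Provisos₁₃SepCoPR` (the twelve rows of `Provisos₁₃SepCoP` with `ztLaws ∕ ztLocal ↦ zrLaws : ∀ p, (θ.Zr p).Laws ∕ zrLocal : ∀ p, (θ.Zr p).LocalLaws`; `bg` := def-R's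
ranged `BgProvisoΛ` over `suppOfRecord₁₃SepCoP … θ.toStage13Params …` AT `UbgOfRecord₁₃CoP … θ.toStage13Params …` — the U-side objects unchanged), `.toCoPR`, datum `datumOfRecord₁₃SepCoPR θ h :=
datumOfRecord₁₃CoPR θ h.toCoPR` (`rfl`), record predicate `IsRecordOfRecord₁₃CSepCoPR` binding worlds over the view `θ.toStage5₁₃CoPR`; NO bridge from the `Zt`-keyed provisos
`Provisos₁₃Core ∕ Sep ∕ SepMixed ∕ SepCo ∕ SepCoP`) and this seat's `Node00/Record13CarriersCoPR` (§0 the R-LEVEL re-binding `Stage13RParams.rebindX` and the ten R-level pins with their `rfl`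
faces, `Stage13RParams.rebindX_admissible_iff`; §1 `toStage5₁₃CoPR_rebindX ∕ _pin<G>` (`rfl`); §5 the views).  THIS LEAF supplies, for the rev-22 consumers that bind worlds at PINNED
Stage-13 `CoPR` views (dag-n24-c's K1 engine ⁶, dag-n08-c's ∕ dag-n12-d's storeys, dag-n22-e's layer B, this seat's N10 storeys, …), exactly the carrier-side faces they read at the v1.5
key in `Record13CarriersSepCoP`: (i) `Provisos₁₃SepCoPR.rebindX ∕ .pin<G>` for `<G>` ∈ {B10, Y, Z, W, B8, B12, B8Sub, B13, X3} — FIELD BY FIELD over ALL TWELVE rows: they read `ν`, `τ9`,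
`ζ`, `ppSel`, `A₁`, `Rz`, `Zr`, `γ`, `gOfRecord₁₃`, `EOfRecord₁₃`, `wOfRecord₉`, `settingOfRecord₁₃`, `suppOfRecord₁₃SepCoP`, `UbgOfRecord₁₃CoP`, `PartCompat₁₃` at `θ.toStage13Params` — never
`res.X ∕ Y ∕ Z ∕ W`; (ii) `datumOfRecord₁₃SepCoPR_rebindX ∕ _pin<G>` — ALL `rfl`: THE PINS ARE UP-SIDE at the v1.6 datum exactly as at every earlier datum; (iii) the v1.6 record at a
re-bound view: `isRecordOfRecord₁₃CSepCoPR_rebindX_of_eq ∕ _pinB10_of_eq ∕ _pinB13_of_eq ∕ _pinX3_of_eq`, `exists_world_isRecordOfRecord₁₃CSepCoPR_rebindX ∕ _pinX3` (world bindings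
`w.up P = upOfRecord₅C F N ((θ.rebindX F N X').toStage5₁₃CoPR F N) P`).  The [B8″] pins `pinB8SubB ∕ pinB8SubBH ∕ pinX3H` (dag-n05-d) are θ-level instances of `rebindX`; their
R-level lifts and named `SepCoPR` faces are one line each through §0 of `Record13CarriersCoPR` and `Provisos₁₃SepCoPR.rebindX` ∕ `datumOfRecord₁₃SepCoPR_rebindX` (theirs by the
one-declarer rule, or declared here on ask).  APPEND-ONLY: a NEW importing leaf (`Record13SepCoPR` ⊇ `Record13CoPR`; `Record13CarriersCoPR` ⊇ `Record13CarriersSep` ⊇ … ⊇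
`Record13Carriers`); NOTHING landed is edited; the v1.1 … v1.5-keyed faces stand verbatim for the siblings.  Generated from this seat's p523276 by `tools/gen_copr.py` (T₆; every proviso
literal rebuilt over the field list READ OFF the landed FILE 26T) and checked by import on the tree — farm rc 0.
[Balaban1988Convergent] = Commun. Math. Phys. **119** (1988) 243–285; [Balaban1989LargeFieldII] = Commun. Math. Phys. **122** (1989) 355–392; [Balaban1985Variational] =
Commun. Math. Phys. **102** (1985) 277–309.

HONEST FRAMING: kernel bookkeeping (structure-instance re-keying and `rfl`); NO estimate; nothing of Bałaban's asserted; the provisos are HYPOTHESIS-SIDE structures, never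
admissibility clauses, never inhabited here; no node discharged; counts unmoved (typed 28∕28 · discharged 5∕27); a typing-faithfulness repair of ONE slot's INDEX in a CONDITIONAL
record; one finite T⁴ programme at fixed ε — NOT continuum ∕ ℝ⁴ ∕ OS ∕ mass gap ∕ Clay.  No `sorry`, no `axiom`, no `def`, no `instance`, no `notation`.
-/

noncomputable section

namespace Literature.MathematicalPhysics.QuantumFieldTheory.Balaban1983to89.Node00

open T4Continuum AveragingRT T4FiniteEpsInhabited FlowStep FlowStepRuns DagBinding T4DatumAssembly
open scoped Matrix.Norms.L2Operator

variable {F : T4Family} {N : ℕ} [NeZero N]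

/-! ## §1. The v1.6 provisos (row P11 on print's sequences with (7)-regular data, background row at print's background) transport along every X-re-binding and every pin; their datum is UP-SIDE -/

section SepCoPR

/-- **The v1.6 provisos read no carrier**: they transport along ANY `X`-re-binding (ten rows, field by field; row `bg` reads `γ`, `gOfRecord₁₃`,
`PartCompat₁₃`, `settingOfRecord₁₃`, `Rz`, `τ9`, `suppOfRecord₁₃SepCoP`, `UbgOfRecord₁₃CoP` — never `res.X`). [cite: Balaban1988Convergent, (2.18) p.257, (2.23)–(2.42) pp.259–262, (3.2)–(3.9) pp.265–266; Balaban1985RegularSpaces, (1.3)–(1.6) p.77 (bookkeeping)] -/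
theorem Stage13RParams.Provisos₁₃SepCoPR.rebindX {θ : Stage13RParams F N} (h : θ.Provisos₁₃SepCoPR F N) (X' : B12.RunParams → PrintedCarriersR) :
    (θ.rebindX F N X').Provisos₁₃SepCoPR F N :=
  { intPiece := h.intPiece, measω := h.measω, measChi := h.measChi, zetaUnity := h.zetaUnity, zetaAbs := h.zetaAbs, rstep := h.rstep, rzLaws := h.rzLaws,
    zrLaws := h.zrLaws, zrLocal := h.zrLocal, hM := h.hM, hM₁ := h.hM₁, bg := h.bg }

/-- … along the [B10] pin … [cite: Balaban1988Convergent, (2.23)–(2.42) pp.259–262 (bookkeeping)] -/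
theorem Stage13RParams.Provisos₁₃SepCoPR.pinB10 {θ : Stage13RParams F N} (h : θ.Provisos₁₃SepCoPR F N) : (θ.pinB10 F N).Provisos₁₃SepCoPR F N :=
  h.rebindX _

/-- … the Y pin … [cite: Balaban1988Convergent, (2.23)–(2.42) pp.259–262 (bookkeeping)] -/
theorem Stage13RParams.Provisos₁₃SepCoPR.pinY {θ : Stage13RParams F N} (h : θ.Provisos₁₃SepCoPR F N) (Y₀ : PrintedCarriers9X) : (θ.pinY F N Y₀).Provisos₁₃SepCoPR F N :=
  { intPiece := h.intPiece, measω := h.measω, measChi := h.measChi, zetaUnity := h.zetaUnity, zetaAbs := h.zetaAbs, rstep := h.rstep, rzLaws := h.rzLaws,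
    zrLaws := h.zrLaws, zrLocal := h.zrLocal, hM := h.hM, hM₁ := h.hM₁, bg := h.bg }

/-- … the Z pin … [cite: Balaban1988Convergent, (2.23)–(2.42) pp.259–262 (bookkeeping)] -/
theorem Stage13RParams.Provisos₁₃SepCoPR.pinZ {θ : Stage13RParams F N} (h : θ.Provisos₁₃SepCoPR F N) (Z₀ : PrintedCarriers11) : (θ.pinZ F N Z₀).Provisos₁₃SepCoPR F N :=
  { intPiece := h.intPiece, measω := h.measω, measChi := h.measChi, zetaUnity := h.zetaUnity, zetaAbs := h.zetaAbs, rstep := h.rstep, rzLaws := h.rzLaws,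
    zrLaws := h.zrLaws, zrLocal := h.zrLocal, hM := h.hM, hM₁ := h.hM₁, bg := h.bg }

/-- … the W pin … [cite: Balaban1988Convergent, (2.23)–(2.42) pp.259–262 (bookkeeping)] -/
theorem Stage13RParams.Provisos₁₃SepCoPR.pinW {θ : Stage13RParams F N} (h : θ.Provisos₁₃SepCoPR F N) (W₀ : B12.RunParams → PrintedCarriers15) :
    (θ.pinW F N W₀).Provisos₁₃SepCoPR F N :=
  { intPiece := h.intPiece, measω := h.measω, measChi := h.measChi, zetaUnity := h.zetaUnity, zetaAbs := h.zetaAbs, rstep := h.rstep, rzLaws := h.rzLaws,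
    zrLaws := h.zrLaws, zrLocal := h.zrLocal, hM := h.hM, hM₁ := h.hM₁, bg := h.bg }

/-- … the [B8] pin … [cite: Balaban1988Convergent, (2.23)–(2.42) pp.259–262 (bookkeeping)] -/
theorem Stage13RParams.Provisos₁₃SepCoPR.pinB8 {θ : Stage13RParams F N} (h : θ.Provisos₁₃SepCoPR F N) (lam : ResidB8 θ.toStage3Params) : (θ.pinB8 F N lam).Provisos₁₃SepCoPR F N :=
  h.rebindX _

/-- … the [B12] pin … [cite: Balaban1988Convergent, (2.23)–(2.42) pp.259–262 (bookkeeping)] -/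
theorem Stage13RParams.Provisos₁₃SepCoPR.pinB12 {θ : Stage13RParams F N} (h : θ.Provisos₁₃SepCoPR F N) (lam : ResidB12 F N θ.τ9.M) : (θ.pinB12 F N lam).Provisos₁₃SepCoPR F N :=
  h.rebindX _

/-- … the [B8′] pin … [cite: Balaban1988Convergent, (2.23)–(2.42) pp.259–262 (bookkeeping)] -/
theorem Stage13RParams.Provisos₁₃SepCoPR.pinB8Sub {θ : Stage13RParams F N} (h : θ.Provisos₁₃SepCoPR F N) (lam : ResidB8 θ.toStage3Params) : (θ.pinB8Sub F N lam).Provisos₁₃SepCoPR F N :=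
  h.rebindX _

/-- … the [B13] pin … [cite: Balaban1988Convergent, (2.23)–(2.42) pp.259–262; Balaban1988RG2Cluster, Lemmas 1–3 pp.9–20 (bookkeeping)] -/
theorem Stage13RParams.Provisos₁₃SepCoPR.pinB13 {θ : Stage13RParams F N} (h : θ.Provisos₁₃SepCoPR F N) (lam : B12.RunParams → ResidB13 θ.toStage3Params) :
    (θ.pinB13 F N lam).Provisos₁₃SepCoPR F N :=
  h.rebindX _

/-- … and the one-level X-pin of the three carrier groups of record. [cite: Balaban1988Convergent, (2.23)–(2.42) pp.259–262 (bookkeeping)] -/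
theorem Stage13RParams.Provisos₁₃SepCoPR.pinX3 {θ : Stage13RParams F N} (h : θ.Provisos₁₃SepCoPR F N) (lam8 : ResidB8 θ.toStage3Params) (lam12 : ResidB12 F N θ.τ9.M)
    (lam13 : B12.RunParams → ResidB13 θ.toStage3Params) : (θ.pinX3 F N lam8 lam12 lam13).Provisos₁₃SepCoPR F N :=
  h.rebindX _

variable (F N)

/-- **THE v1.6 DATUM DOES NOT READ THE CARRIER BUNDLE `X`** (`rfl`, once, at a generic re-binding). [cite: Balaban1989LargeFieldII, Thm 1 + (0.1) pp.355–356 (bookkeeping)] -/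
theorem datumOfRecord₁₃SepCoPR_rebindX (θ : Stage13RParams F N) (h : θ.Provisos₁₃SepCoPR F N) (X' : B12.RunParams → PrintedCarriersR)
    (h' : (θ.rebindX F N X').Provisos₁₃SepCoPR F N) : datumOfRecord₁₃SepCoPR F N (θ.rebindX F N X') h' = datumOfRecord₁₃SepCoPR F N θ h := rfl

/-- **THE PINS ARE UP-SIDE at the v1.6 datum**: the [B10] pin (`rfl`) … [cite: Balaban1989LargeFieldII, Thm 1 + (0.1) pp.355–356; Balaban1985UV3, Thm 1 p.257 (bookkeeping)] -/
theorem datumOfRecord₁₃SepCoPR_pinB10 (θ : Stage13RParams F N) (h : θ.Provisos₁₃SepCoPR F N) :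
    datumOfRecord₁₃SepCoPR F N (θ.pinB10 F N) h.pinB10 = datumOfRecord₁₃SepCoPR F N θ h :=
  datumOfRecord₁₃SepCoPR_rebindX F N θ h _ h.pinB10

/-- … the Y pin (`rfl`) … [cite: Balaban1989LargeFieldII, Thm 1 + (0.1) pp.355–356 (bookkeeping)] -/
theorem datumOfRecord₁₃SepCoPR_pinY (θ : Stage13RParams F N) (h : θ.Provisos₁₃SepCoPR F N) (Y₀ : PrintedCarriers9X) :
    datumOfRecord₁₃SepCoPR F N (θ.pinY F N Y₀) (h.pinY Y₀) = datumOfRecord₁₃SepCoPR F N θ h := rfl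

/-- … the Z pin (`rfl`) … [cite: Balaban1989LargeFieldII, Thm 1 + (0.1) pp.355–356 (bookkeeping)] -/
theorem datumOfRecord₁₃SepCoPR_pinZ (θ : Stage13RParams F N) (h : θ.Provisos₁₃SepCoPR F N) (Z₀ : PrintedCarriers11) :
    datumOfRecord₁₃SepCoPR F N (θ.pinZ F N Z₀) (h.pinZ Z₀) = datumOfRecord₁₃SepCoPR F N θ h := rfl

/-- … the W pin (`rfl`) … [cite: Balaban1989LargeFieldII, Thm 1 + (0.1) pp.355–356 (bookkeeping)] -/
theorem datumOfRecord₁₃SepCoPR_pinW (θ : Stage13RParams F N) (h : θ.Provisos₁₃SepCoPR F N) (W₀ : B12.RunParams → PrintedCarriers15) :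
    datumOfRecord₁₃SepCoPR F N (θ.pinW F N W₀) (h.pinW W₀) = datumOfRecord₁₃SepCoPR F N θ h := rfl

/-- … the [B8] pin (`rfl`) … [cite: Balaban1989LargeFieldII, Thm 1 + (0.1) pp.355–356 (bookkeeping)] -/
theorem datumOfRecord₁₃SepCoPR_pinB8 (θ : Stage13RParams F N) (h : θ.Provisos₁₃SepCoPR F N) (lam : ResidB8 θ.toStage3Params) :
    datumOfRecord₁₃SepCoPR F N (θ.pinB8 F N lam) (h.pinB8 lam) = datumOfRecord₁₃SepCoPR F N θ h :=
  datumOfRecord₁₃SepCoPR_rebindX F N θ h _ (h.pinB8 lam)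

/-- … the [B12] pin (`rfl`) … [cite: Balaban1989LargeFieldII, Thm 1 + (0.1) pp.355–356 (bookkeeping)] -/
theorem datumOfRecord₁₃SepCoPR_pinB12 (θ : Stage13RParams F N) (h : θ.Provisos₁₃SepCoPR F N) (lam : ResidB12 F N θ.τ9.M) :
    datumOfRecord₁₃SepCoPR F N (θ.pinB12 F N lam) (h.pinB12 lam) = datumOfRecord₁₃SepCoPR F N θ h :=
  datumOfRecord₁₃SepCoPR_rebindX F N θ h _ (h.pinB12 lam)

/-- … the [B8′] pin (`rfl`) … [cite: Balaban1989LargeFieldII, Thm 1 + (0.1) pp.355–356 (bookkeeping)] -/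
theorem datumOfRecord₁₃SepCoPR_pinB8Sub (θ : Stage13RParams F N) (h : θ.Provisos₁₃SepCoPR F N) (lam : ResidB8 θ.toStage3Params) :
    datumOfRecord₁₃SepCoPR F N (θ.pinB8Sub F N lam) (h.pinB8Sub lam) = datumOfRecord₁₃SepCoPR F N θ h :=
  datumOfRecord₁₃SepCoPR_rebindX F N θ h _ (h.pinB8Sub lam)

/-- … the [B13] pin (`rfl`) … [cite: Balaban1989LargeFieldII, Thm 1 + (0.1) pp.355–356; Balaban1988RG2Cluster, Lemmas 1–3 pp.9–20 (bookkeeping)] -/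
theorem datumOfRecord₁₃SepCoPR_pinB13 (θ : Stage13RParams F N) (h : θ.Provisos₁₃SepCoPR F N) (lam : B12.RunParams → ResidB13 θ.toStage3Params) :
    datumOfRecord₁₃SepCoPR F N (θ.pinB13 F N lam) (h.pinB13 lam) = datumOfRecord₁₃SepCoPR F N θ h :=
  datumOfRecord₁₃SepCoPR_rebindX F N θ h _ (h.pinB13 lam)

/-- … and the one-level X-pin (`rfl`). [cite: Balaban1989LargeFieldII, Thm 1 + (0.1) pp.355–356 (bookkeeping)] -/
theorem datumOfRecord₁₃SepCoPR_pinX3 (θ : Stage13RParams F N) (h : θ.Provisos₁₃SepCoPR F N) (lam8 : ResidB8 θ.toStage3Params) (lam12 : ResidB12 F N θ.τ9.M)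
    (lam13 : B12.RunParams → ResidB13 θ.toStage3Params) :
    datumOfRecord₁₃SepCoPR F N (θ.pinX3 F N lam8 lam12 lam13) (h.pinX3 lam8 lam12 lam13) = datumOfRecord₁₃SepCoPR F N θ h :=
  datumOfRecord₁₃SepCoPR_rebindX F N θ h _ (h.pinX3 lam8 lam12 lam13)

end SepCoPR

/-! ## §2. The v1.6 record `IsRecordOfRecord₁₃CSepCoPR` presented at a re-bound ∕ pinned Stage-13 view (same datum, `datumOfRecord₁₃SepCoPR_rebindX`) -/

section Records

variable (F N)

/-- **Pointed form, generic re-binding, v1.6 vocabulary**: a world with def-T's pointed clauses — construction `(datumOfRecord₁₃SepCoPR θ h).C`, window `0 < w.γ ≤ θ.γ`, block size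
`θ.L` — whose upstream blocks are the C-binding over the Stage-13 `CoPR` view of the RE-BOUND parameters IS a v1.6 ₁₃C record at `datumOfRecord₁₃SepCoPR θ h` (presenting parameter
`θ.rebindX X'`). [cite: Balaban1989LargeFieldII, Thm 1 + (0.1) pp.355–356 (bookkeeping)] -/
theorem isRecordOfRecord₁₃CSepCoPR_rebindX_of_eq (θ : Stage13RParams F N) (h : θ.Provisos₁₃SepCoPR F N) (hθ : θ.Admissible F N) (X' : B12.RunParams → PrintedCarriersR)
    (w : WorldP) (hC : w.C = (datumOfRecord₁₃SepCoPR F N θ h).C) (hγ : 0 < w.γ ∧ w.γ ≤ θ.γ) (hL : w.L = (θ.L : ℝ))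
    (hup : ∀ P, w.up P = upOfRecord₅C F N ((θ.rebindX F N X').toStage5₁₃CoPR F N) P) :
    IsRecordOfRecord₁₃CSepCoPR F N (datumOfRecord₁₃SepCoPR F N θ h) w :=
  ⟨θ.rebindX F N X', h.rebindX X', (Stage13RParams.rebindX_admissible_iff F N θ X').2 hθ, (datumOfRecord₁₃SepCoPR_rebindX F N θ h X' (h.rebindX X')).symm,
    hC, hγ, hL, hup⟩

/-- **EVERY admissible Stage-13 parameter with the v1.6 provisos presents a v1.6 ₁₃C record at its own datum whose world is bound over ANY re-bound Stage-13 `CoPR` view**, any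
window `0 < γw ≤ θ.γ`, block size `θ.L`. [cite: Balaban1989LargeFieldII, Thm 1 + (0.1) pp.355–356 (bookkeeping)] -/
theorem exists_world_isRecordOfRecord₁₃CSepCoPR_rebindX (θ : Stage13RParams F N) (h : θ.Provisos₁₃SepCoPR F N) (hθ : θ.Admissible F N) (X' : B12.RunParams → PrintedCarriersR)
    {γw : ℝ} (hγw : 0 < γw ∧ γw ≤ θ.γ) :
    ∃ w : WorldP, IsRecordOfRecord₁₃CSepCoPR F N (datumOfRecord₁₃SepCoPR F N θ h) w ∧ w.γ = γw ∧ w.L = (θ.L : ℝ) ∧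
      ∀ P, w.up P = upOfRecord₅C F N ((θ.rebindX F N X').toStage5₁₃CoPR F N) P := by
  obtain ⟨w₀⟩ := nonempty_worldP
  exact ⟨{ w₀ with
      C := (datumOfRecord₁₃SepCoPR F N θ h).C, γ := γw, L := (θ.L : ℝ), one_lt_L := by exact_mod_cast θ.hL.2,
      up := fun P => upOfRecord₅C F N ((θ.rebindX F N X').toStage5₁₃CoPR F N) P },
    isRecordOfRecord₁₃CSepCoPR_rebindX_of_eq F N θ h hθ X' _ rfl hγw rfl (fun _ => rfl), rfl, rfl, fun _ => rfl⟩

/-- The [B10] instance (dag-n08-c's N08 ₁₃ storeys read it by name). [cite: Balaban1989LargeFieldII, Thm 1 + (0.1) pp.355–356; Balaban1985UV3, Thm 1 p.257 (bookkeeping)] -/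
theorem isRecordOfRecord₁₃CSepCoPR_pinB10_of_eq (θ : Stage13RParams F N) (h : θ.Provisos₁₃SepCoPR F N) (hθ : θ.Admissible F N)
    (w : WorldP) (hC : w.C = (datumOfRecord₁₃SepCoPR F N θ h).C) (hγ : 0 < w.γ ∧ w.γ ≤ θ.γ) (hL : w.L = (θ.L : ℝ))
    (hup : ∀ P, w.up P = upOfRecord₅C F N ((θ.pinB10 F N).toStage5₁₃CoPR F N) P) :
    IsRecordOfRecord₁₃CSepCoPR F N (datumOfRecord₁₃SepCoPR F N θ h) w :=
  isRecordOfRecord₁₃CSepCoPR_rebindX_of_eq F N θ h hθ _ w hC hγ hL hup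

/-- The [B13] instance (this seat's N10 ₁₃ storeys read it by name). [cite: Balaban1989LargeFieldII, Thm 1 + (0.1) pp.355–356; Balaban1988RG2Cluster, Lemmas 1–3 pp.9–20 (bookkeeping)] -/
theorem isRecordOfRecord₁₃CSepCoPR_pinB13_of_eq (θ : Stage13RParams F N) (h : θ.Provisos₁₃SepCoPR F N) (hθ : θ.Admissible F N)
    (lam : B12.RunParams → ResidB13 θ.toStage3Params) (w : WorldP) (hC : w.C = (datumOfRecord₁₃SepCoPR F N θ h).C) (hγ : 0 < w.γ ∧ w.γ ≤ θ.γ) (hL : w.L = (θ.L : ℝ))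
    (hup : ∀ P, w.up P = upOfRecord₅C F N ((θ.pinB13 F N lam).toStage5₁₃CoPR F N) P) :
    IsRecordOfRecord₁₃CSepCoPR F N (datumOfRecord₁₃SepCoPR F N θ h) w :=
  isRecordOfRecord₁₃CSepCoPR_rebindX_of_eq F N θ h hθ _ w hC hγ hL hup

/-- The X-pinned instance (dag-n24-c's K1 engine closers read it by name). [cite: Balaban1989LargeFieldII, Thm 1 + (0.1) pp.355–356 (bookkeeping)] -/
theorem isRecordOfRecord₁₃CSepCoPR_pinX3_of_eq (θ : Stage13RParams F N) (h : θ.Provisos₁₃SepCoPR F N) (hθ : θ.Admissible F N) (lam8 : ResidB8 θ.toStage3Params)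
    (lam12 : ResidB12 F N θ.τ9.M) (lam13 : B12.RunParams → ResidB13 θ.toStage3Params) (w : WorldP) (hC : w.C = (datumOfRecord₁₃SepCoPR F N θ h).C)
    (hγ : 0 < w.γ ∧ w.γ ≤ θ.γ) (hL : w.L = (θ.L : ℝ)) (hup : ∀ P, w.up P = upOfRecord₅C F N ((θ.pinX3 F N lam8 lam12 lam13).toStage5₁₃CoPR F N) P) :
    IsRecordOfRecord₁₃CSepCoPR F N (datumOfRecord₁₃SepCoPR F N θ h) w :=
  isRecordOfRecord₁₃CSepCoPR_rebindX_of_eq F N θ h hθ _ w hC hγ hL hup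

/-- Every admissible Stage-13 parameter with the v1.6 provisos presents a v1.6 ₁₃C record of its own datum over the X-pinned Stage-13 `CoPR` view, any window `0 < γw ≤ θ.γ`,
block size `θ.L`. [cite: Balaban1989LargeFieldII, Thm 1 + (0.1) pp.355–356 (bookkeeping)] -/
theorem exists_world_isRecordOfRecord₁₃CSepCoPR_pinX3 (θ : Stage13RParams F N) (h : θ.Provisos₁₃SepCoPR F N) (hθ : θ.Admissible F N) (lam8 : ResidB8 θ.toStage3Params)
    (lam12 : ResidB12 F N θ.τ9.M) (lam13 : B12.RunParams → ResidB13 θ.toStage3Params) {γw : ℝ} (hγw : 0 < γw ∧ γw ≤ θ.γ) :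
    ∃ w : WorldP, IsRecordOfRecord₁₃CSepCoPR F N (datumOfRecord₁₃SepCoPR F N θ h) w ∧ w.γ = γw ∧ w.L = (θ.L : ℝ) ∧
      ∀ P, w.up P = upOfRecord₅C F N ((θ.pinX3 F N lam8 lam12 lam13).toStage5₁₃CoPR F N) P :=
  exists_world_isRecordOfRecord₁₃CSepCoPR_rebindX F N θ h hθ _ hγw

end Records

end Literature.MathematicalPhysics.QuantumFieldTheory.Balaban1983to89.Node00

end
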